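import Mathlib
import Literature.Computability.AlgebraicComplexity.PermanentIrreducible

/-!
# Crux `DivisionGap.PerCofactorDegreeReduction` (stmt-ValiantsHypothesis-15046), line `Sketch` —
# stub `stub_positiveVanishingDegree`: nonnegative polynomials of small degree do not vanish near `1`
# on the torus

**Theorem (`stub_positiveVanishingDegree`).** Let `F ∈ ℝ≥0[x_e : e ∈ σ]` (`σ` finite) be nonzero,
let `θ : σ → ℝ` with `|θ_e| ≤ ε` for all `e`, and assume `deg F · ε < π / 2`.  Then the
complexification of `F` has POSITIVE real part at the torus point `(e^{i θ_e})_e`.  In particular a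
polynomial with nonnegative coefficients vanishing at such a point has total degree `≥ π / (2 ε)`.

## Proof

Expand `F(e^{iθ}) = Σ_{d ∈ supp F} F_d · Π_e e^{i d_e θ_e} = Σ_d F_d · e^{i ⟨d, θ⟩}`
(`MvPolynomial.eval₂_eq'`, `Complex.exp_sum`), so `Re F(e^{iθ}) = Σ_d F_d cos ⟨d, θ⟩`.  For
`d ∈ supp F`, `F_d > 0` and `|⟨d, θ⟩| ≤ |d| ε ≤ deg F · ε < π / 2` (when `ε < 0` the index type is
empty and `⟨d, θ⟩ = 0`), so `cos ⟨d, θ⟩ > 0`; the support is nonempty since `F ≠ 0`, hence the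
sum is positive (`Finset.sum_pos`).
-/

noncomputable section

-- `Summit.ValiantsHypothesis.ValiantsHypothesis.…` is the tree's mandated single-conjunct layout
-- (Problem = Summit), so the duplicated namespace component is intended.
set_option linter.dupNamespace false

namespace Summit.ValiantsHypothesis.ValiantsHypothesis.Theorems.DivisionGap.PerCofactorDegreeReduction.PositiveVanishingDegree

open MvPolynomial Literature.Computability.AlgebraicComplexity
open scoped NNReal

/-- **Phase bound.** If `|θ_e| ≤ ε` for every `e` and `d` is an exponent vector of a nonzero
`F ∈ ℝ≥0[x]` with `deg F · ε < π / 2`, then `|Σ_e d_e θ_e| < π / 2`: indeed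
`|Σ_e d_e θ_e| ≤ Σ_e d_e |θ_e| ≤ |d| ε ≤ deg F · ε` when `ε ≥ 0`, while `ε < 0` forces `σ` to be
empty and the sum to vanish. [folklore] -/
theorem abs_phase_lt {σ : Type} [Fintype σ] {F : MvPolynomial σ ℝ≥0} {θ : σ → ℝ} {ε : ℝ}
    (hθ : ∀ e, |θ e| ≤ ε) (hdeg : (F.totalDegree : ℝ) * ε < Real.pi / 2) {d : σ →₀ ℕ}
    (hd : d ∈ F.support) : |∑ e, (d e : ℝ) * θ e| < Real.pi / 2 := by
  rcases le_or_gt 0 ε with hε | hε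
  · -- `ε ≥ 0`: the chain of inequalities
    have hsum : ((∑ e, d e : ℕ) : ℝ) ≤ F.totalDegree := by
      have h := MvPolynomial.le_totalDegree hd
      rw [Finsupp.sum_fintype _ _ fun _ => rfl] at h
      exact_mod_cast h
    calc |∑ e, (d e : ℝ) * θ e| ≤ ∑ e, |(d e : ℝ) * θ e| := Finset.abs_sum_le_sum_abs _ _
      _ = ∑ e, (d e : ℝ) * |θ e| := by simp_rw [abs_mul, Nat.abs_cast]
      _ ≤ ∑ e, (d e : ℝ) * ε :=
          Finset.sum_le_sum fun e _ => mul_le_mul_of_nonneg_left (hθ e) (Nat.cast_nonneg _)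
      _ = ((∑ e, d e : ℕ) : ℝ) * ε := by rw [Nat.cast_sum, Finset.sum_mul]
      _ ≤ (F.totalDegree : ℝ) * ε := mul_le_mul_of_nonneg_right hsum hε
      _ < Real.pi / 2 := hdeg
  · -- `ε < 0`: no index exists, the phase is `0`
    have hno : ∀ e : σ, False := fun e => ((hθ e).trans_lt hε).not_ge (abs_nonneg _)
    rw [Finset.sum_eq_zero fun e _ => (hno e).elim, abs_zero]
    exact half_pos Real.pi_pos

/-- **Termwise real part.** The `d`-th term of the expansion of `F(e^{iθ})` — the complexified
coefficient `F_d` times `Π_e (e^{i θ_e})^{d_e}` — has real part `F_d · cos (Σ_e d_e θ_e)`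
(`Complex.exp_sum`, `Complex.exp_ofReal_mul_I_re`). [folklore] -/
theorem term_re {σ : Type} [Fintype σ] (F : MvPolynomial σ ℝ≥0) (θ : σ → ℝ) (d : σ →₀ ℕ) :
    ((Complex.ofRealHom.comp NNReal.toRealHom) (F.coeff d) *
        ∏ e, Complex.exp ((θ e : ℂ) * Complex.I) ^ d e).re =
      ((F.coeff d : ℝ≥0) : ℝ) * Real.cos (∑ e, (d e : ℝ) * θ e) := by
  have hprod : ∏ e, Complex.exp ((θ e : ℂ) * Complex.I) ^ d e =
      Complex.exp ((↑(∑ e, (d e : ℝ) * θ e) : ℂ) * Complex.I) := by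
    rw [Complex.ofReal_sum, Finset.sum_mul, Complex.exp_sum]
    refine Finset.prod_congr rfl fun e _ => ?_
    rw [← Complex.exp_nat_mul, Complex.ofReal_mul, Complex.ofReal_natCast, mul_assoc]
  rw [hprod, RingHom.comp_apply, NNReal.coe_toRealHom, Complex.ofRealHom_eq_coe,
    Complex.re_ofReal_mul, Complex.exp_ofReal_mul_I_re]

/-- **stub_positiveVanishingDegree — nonnegative polynomials of small degree have positive real
part near `1` on the torus.**  For a nonzero `F ∈ ℝ≥0[x_e : e ∈ σ]` (`σ` finite), angles
`|θ_e| ≤ ε` and `deg F · ε < π / 2`, the complexification of `F` evaluated at `(e^{i θ_e})_e` has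
positive real part: `Re F(e^{iθ}) = Σ_{d ∈ supp F} F_d cos ⟨d, θ⟩` (`MvPolynomial.eval₂_eq'`,
`term_re`) with every `F_d > 0` and `|⟨d, θ⟩| < π / 2` (`abs_phase_lt`), so every term is positive
and the (nonempty) sum is positive. [folklore; archimedean input of the c4 reshape] -/
theorem stub_positiveVanishingDegree {σ : Type} [Fintype σ] (F : MvPolynomial σ ℝ≥0) (hF : F ≠ 0)
    (θ : σ → ℝ) (ε : ℝ) (hθ : ∀ e, |θ e| ≤ ε)
    (hdeg : (F.totalDegree : ℝ) * ε < Real.pi / 2) :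
    0 < (MvPolynomial.eval (fun e => Complex.exp ((θ e : ℂ) * Complex.I))
      (MvPolynomial.map (Complex.ofRealHom.comp NNReal.toRealHom) F)).re := by
  rw [MvPolynomial.eval_map, MvPolynomial.eval₂_eq', Complex.re_sum]
  simp_rw [term_re]
  refine Finset.sum_pos (fun d hd => mul_pos ?_ ?_) (MvPolynomial.support_nonempty.2 hF)
  · exact NNReal.coe_pos.2 (pos_iff_ne_zero.2 (MvPolynomial.mem_support_iff.1 hd))
  · exact Real.cos_pos_of_mem_Ioo (abs_lt.1 (abs_phase_lt hθ hdeg hd))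

end Summit.ValiantsHypothesis.ValiantsHypothesis.Theorems.DivisionGap.PerCofactorDegreeReduction.PositiveVanishingDegree

end
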